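import Summits.ResolutionOfSingularities.ResolutionOfSingularities.Theorems.EquisingularLiftEquisingularLiftNatSmoothConeBlowup
import HarnessLib

/-!
# [OURS · L1 W4.5(b) · EL♮(3)] T-EBETA-PRIME, part 3: the S-F TIE CUBIC `v·T₀T₁(T₀+T₁) + w·T₂³` — the (E-β′) centre
# `Bl_q(D)` at a tie point is regular along its exceptional curve, the smooth plane cubic

Support file of the crux chain w45b (cell `res-hironaka`, LADDER-RESOLUTION rung L, slot W4.5(b)), working crux
**EL♮ = `Theses.EquisingularLift.EquisingularLiftNat`** (stmt-ResolutionOfSingularities-20038) and its `n = 3` child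
`EquisingularLiftNatThree` (stmt-ResolutionOfSingularities-20148), registered stub `stub_elnat_three_isolated_nonabs`
(line `sections`); K4.5e arm T (specimen S-F of res-L1-w45b-plan-1, `L/w45b/SPECIMEN-S-F.md`; device (E-β′) of
PLANNER-MEMO v2 M3 / res-L1-w45b-lead-2 LEAD-MEMO-2 §5–§6 and CENSUS 2026-08-27T07:19:19Z «D = V(F̃₇ + ϖ³U) with U(q)
matched to the tie coefficient has TC_q(D) = cone over the smooth cubic, Bl_q D regular, fibre = the reduced cubic»).
OURS; NOT a statement of any manuscript; AI-written, weaker than expert review. Filed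
`--supports stmt-ResolutionOfSingularities-20148 --as helper` by res-L1-w45b-stub-3 (object T-EBETA-PRIME).

SETTING. At a tie point `q_j` of S-F (three of the seven lines of `PG(2, 2)` through `q_j`; residue characteristic
`2`), in local parameters `x = ℓ̃₁`, `y = ℓ̃₂`, `ϖ` of the carrier `E_O ≅ ℙ²_{O′}` at the `O′`-point `q̃_j` (the third
line `ℓ̃₃ ≡ a x + b y (mod ϖ³)`, ramification `e ≥ 3`), the `O′`-model is `D = V(G)` with
`G = V·xy(ax + by) + ϖ³(U + …)`: its degree-3 initial form is the TIE CUBIC `Φ = v·T₀T₁(T₀+T₁) + w·T₂³` (after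
rescaling the coordinates; `v = V(q)`, `w = U(q)` units) and `G = Φ(x, y, ϖ) + Ψ`, `Ψ ∈ 𝔪⁴`. This file discharges
the Jacobian hypothesis of part 2 for `Φ`, at the ring level and for ANY regular `A` with `A/I` regular:

* `one_mem_jacobian_tieCubic_vertexChart`, `one_mem_jacobian_tieCubic_lineChart` (any coefficient ring `k`, any
  index type): the affine cubics `v T_aT_b(T_a+T_b) + w` and `v T_b(1+T_b) + w T_c³` satisfy
  `1 ∈ (P) + (∂P/∂T_j : j)` as soon as `3`, `w` (resp. `3`, `v`) are units — Euler-type identities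
  `3P − T_a∂_aP − T_b∂_bP = 3w` and `3(1+2T_b)∂_bP − 12P + 4T_c∂_cP = 3v`;
* `isHomogeneous_tieCubic`, `map_dehomogenize_tieCubic`, `one_mem_jacobian_tieCubic` — the tie cubic is a form of
  degree `3` whose three reduced dehomogenisations are the affine cubics above, hence **the Jacobian condition of
  part 2 holds on EVERY chart** when `3`, `v̄`, `w̄` are units of `A/I` (residue characteristic `2`: `3 = 1`; it FAILS in
  residue characteristic `3`, where `T₀T₁(T₀+T₁) + T₂³` is singular at `[1:1:1]` — not claimed);
* **`isRegularLocalRing_quotient_strictTransform_tieCubic`** — consequently, for `G = Φ(x) + Ψ`, `Ψ ∈ I⁴`, on every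
  chart `A[I/xᵢ]` and at every prime `𝔐 ⊇ (t, g₁)` of the exceptional divisor, the local ring `A[I/xᵢ]_𝔐/(g₁)` of the
  strict transform is REGULAR: `Bl_q(D)` is regular along its whole exceptional curve, which by part 1
  (`exists_quotient_strictTransform_sup_equiv`) is the smooth cubic `v̄T₀T₁(T₀+T₁) + w̄T₂³ = 0` — the «regular centre,
  E1 via the reduced cubic» half of the K4.5e arm-T prediction, `H`-independent.

Not addressed (and said so): the E1 MATCHING of this cubic with `ℙ(TC_q H₁)` (the jet condition on the transversal
section, LEAD-MEMO-2 §6), the points of `Bl_q(D)` off the exceptional curve, `O′`-flatness, and the global assembly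
of the centre as an ideal sheaf.

References: Matsumura, *Commutative Ring Theory*, Thm. 14.2; Liu, *Algebraic Geometry and Arithmetic Curves*,
Thm. 8.1.19 (a). Tree inputs: parts 1–2 (`…NatSmoothConeBlowupChart`, `…NatSmoothConeBlowup`).
-/

set_option linter.dupNamespace false -- mandated namespace `Summit.<Summit>.<Problem>` of this single-conjunct summit

noncomputable section

namespace Summit.ResolutionOfSingularities.ResolutionOfSingularities.Cruxes.EquisingularLiftNat.Sections

open MvPolynomial IsLocalization IsLocalRing Literature.AlgebraicGeometry.Resolution

universe u

/-! ## The S-F tie cubic `Φ = v·T₀T₁(T₀+T₁) + w·T₂³`: Jacobian condition on the three charts -/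

section TieCubicGeneric

variable {k : Type u} [CommRing k] {σ : Type}

/-- Bookkeeping: if `C u ∈ J` for a unit `u` of the coefficient ring, then `1 ∈ J`. [folklore] -/
theorem one_mem_of_C_mem_of_isUnit {J : Ideal (MvPolynomial σ k)} {u : k} (hu : IsUnit u)
    (h : (MvPolynomial.C u : MvPolynomial σ k) ∈ J) : (1 : MvPolynomial σ k) ∈ J := by
  have htop : J = ⊤ := Ideal.eq_top_of_isUnit_mem J h (hu.map MvPolynomial.C)
  rw [htop]
  exact Submodule.mem_top

/-- **The `T₂`-chart of the tie cubic is smooth**: for `P = v·T_a T_b (T_a + T_b) + w` (the dehomogenisation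
`T₂ := 1` of `v·T₀T₁(T₀+T₁) + w·T₂³`) and `3`, `w` units, `1 ∈ (P) + (∂P/∂T_j : j)` — Euler:
`T_a ∂_a P + T_b ∂_b P = 3P − 3w`. [folklore] -/
theorem one_mem_jacobian_tieCubic_vertexChart (a b : σ) (hab : a ≠ b) (v w : k) (h3 : IsUnit (3 : k))
    (hw : IsUnit w) :
    (1 : MvPolynomial σ k) ∈
      Ideal.span {MvPolynomial.C v * (MvPolynomial.X a * MvPolynomial.X b * (MvPolynomial.X a + MvPolynomial.X b)) +
          MvPolynomial.C w} ⊔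
        Ideal.span (Set.range fun j : σ => MvPolynomial.pderiv j
          (MvPolynomial.C v * (MvPolynomial.X a * MvPolynomial.X b * (MvPolynomial.X a + MvPolynomial.X b)) +
            MvPolynomial.C w)) := by
  set P : MvPolynomial σ k :=
    MvPolynomial.C v * (MvPolynomial.X a * MvPolynomial.X b * (MvPolynomial.X a + MvPolynomial.X b)) +
      MvPolynomial.C w with hP
  set J := Ideal.span {P} ⊔ Ideal.span (Set.range fun j : σ => MvPolynomial.pderiv j P) with hJ
  have hba : b ≠ a := fun h => hab h.symm
  have hDa : MvPolynomial.pderiv a P =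
      MvPolynomial.C v * (MvPolynomial.X b * (MvPolynomial.X a + MvPolynomial.X b) +
        MvPolynomial.X a * MvPolynomial.X b) := by
    simp only [hP, map_add, Derivation.leibniz, MvPolynomial.pderiv_C, MvPolynomial.pderiv_X_self,
      MvPolynomial.pderiv_X_of_ne hba, smul_eq_mul, mul_one, mul_zero, add_zero, zero_add]
    ring
  have hDb : MvPolynomial.pderiv b P =
      MvPolynomial.C v * (MvPolynomial.X a * (MvPolynomial.X a + MvPolynomial.X b) +
        MvPolynomial.X a * MvPolynomial.X b) := by
    simp only [hP, map_add, Derivation.leibniz, MvPolynomial.pderiv_C, MvPolynomial.pderiv_X_self,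
      MvPolynomial.pderiv_X_of_ne hab, smul_eq_mul, mul_one, mul_zero, add_zero, zero_add]
    ring
  have hPJ : P ∈ J := Submodule.mem_sup_left (Ideal.mem_span_singleton_self P)
  have hDaJ : MvPolynomial.pderiv a P ∈ J := Submodule.mem_sup_right (Ideal.subset_span ⟨a, rfl⟩)
  have hDbJ : MvPolynomial.pderiv b P ∈ J := Submodule.mem_sup_right (Ideal.subset_span ⟨b, rfl⟩)
  have hkey : (MvPolynomial.C (3 * w) : MvPolynomial σ k) =
      3 * P - MvPolynomial.X a * MvPolynomial.pderiv a P - MvPolynomial.X b * MvPolynomial.pderiv b P := by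
    rw [hDa, hDb, hP, map_mul, map_ofNat]
    ring
  have hmem : (MvPolynomial.C (3 * w) : MvPolynomial σ k) ∈ J := by
    rw [hkey]
    exact J.sub_mem (J.sub_mem (J.mul_mem_left _ hPJ) (J.mul_mem_left _ hDaJ)) (J.mul_mem_left _ hDbJ)
  exact one_mem_of_C_mem_of_isUnit (h3.mul hw) hmem

/-- **The `T₀`- and `T₁`-charts of the tie cubic are smooth**: for `P = v·T_b(1 + T_b) + w·T_c³` (the
dehomogenisation `T₀ := 1`, resp. `T₁ := 1`, of `v·T₀T₁(T₀+T₁) + w·T₂³`) and `3`, `v` units, `1 ∈ (P) + (∂P/∂T_j : j)`: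
`3(1 + 2T_b) ∂_b P − 12 P + 4 T_c ∂_c P = 3v`. [folklore] -/
theorem one_mem_jacobian_tieCubic_lineChart (b c : σ) (hbc : b ≠ c) (v w : k) (h3 : IsUnit (3 : k))
    (hv : IsUnit v) :
    (1 : MvPolynomial σ k) ∈
      Ideal.span {MvPolynomial.C v * (MvPolynomial.X b * (1 + MvPolynomial.X b)) +
          MvPolynomial.C w * MvPolynomial.X c ^ 3} ⊔
        Ideal.span (Set.range fun j : σ => MvPolynomial.pderiv j
          (MvPolynomial.C v * (MvPolynomial.X b * (1 + MvPolynomial.X b)) +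
            MvPolynomial.C w * MvPolynomial.X c ^ 3)) := by
  set P : MvPolynomial σ k :=
    MvPolynomial.C v * (MvPolynomial.X b * (1 + MvPolynomial.X b)) + MvPolynomial.C w * MvPolynomial.X c ^ 3 with hP
  set J := Ideal.span {P} ⊔ Ideal.span (Set.range fun j : σ => MvPolynomial.pderiv j P) with hJ
  have hcb : c ≠ b := fun h => hbc h.symm
  have hDb : MvPolynomial.pderiv b P = MvPolynomial.C v * (1 + 2 * MvPolynomial.X b) := by
    simp only [hP, map_add, Derivation.leibniz, Derivation.leibniz_pow, Derivation.map_one_eq_zero,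
      MvPolynomial.pderiv_C, MvPolynomial.pderiv_X_self, MvPolynomial.pderiv_X_of_ne hcb, smul_eq_mul, mul_one,
      mul_zero, add_zero, smul_zero]
    ring
  have hDc : MvPolynomial.pderiv c P = MvPolynomial.C w * (3 * MvPolynomial.X c ^ 2) := by
    simp only [hP, map_add, Derivation.leibniz, Derivation.leibniz_pow, Derivation.map_one_eq_zero,
      MvPolynomial.pderiv_C, MvPolynomial.pderiv_X_self, MvPolynomial.pderiv_X_of_ne hbc, smul_eq_mul, mul_one,
      mul_zero, add_zero, nsmul_eq_mul]
    push_cast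
    ring
  have hPJ : P ∈ J := Submodule.mem_sup_left (Ideal.mem_span_singleton_self P)
  have hDbJ : MvPolynomial.pderiv b P ∈ J := Submodule.mem_sup_right (Ideal.subset_span ⟨b, rfl⟩)
  have hDcJ : MvPolynomial.pderiv c P ∈ J := Submodule.mem_sup_right (Ideal.subset_span ⟨c, rfl⟩)
  have hkey : (MvPolynomial.C (3 * v) : MvPolynomial σ k) =
      3 * (1 + 2 * MvPolynomial.X b) * MvPolynomial.pderiv b P - 12 * P +
        4 * MvPolynomial.X c * MvPolynomial.pderiv c P := by
    rw [hDb, hDc, hP, map_mul, map_ofNat]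
    ring
  have hmem : (MvPolynomial.C (3 * v) : MvPolynomial σ k) ∈ J := by
    rw [hkey]
    exact J.add_mem (J.sub_mem (J.mul_mem_left _ hDbJ) (J.mul_mem_left _ hPJ)) (J.mul_mem_left _ hDcJ)
  exact one_mem_of_C_mem_of_isUnit (h3.mul hv) hmem

end TieCubicGeneric

section TieCubic

variable {A : Type u} [CommRing A] (x : Fin 3 → A)

/-- The tie cubic `v·T₀T₁(T₀+T₁) + w·T₂³` is a form of degree `3`. [folklore] -/
theorem isHomogeneous_tieCubic (v w : A) :
    (MvPolynomial.C v * (MvPolynomial.X 0 * MvPolynomial.X 1 * (MvPolynomial.X 0 + MvPolynomial.X 1)) +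
      MvPolynomial.C w * MvPolynomial.X 2 ^ 3 : MvPolynomial (Fin 3) A).IsHomogeneous 3 := by
  refine MvPolynomial.IsHomogeneous.add ?_ ?_
  · have h : ((MvPolynomial.X 0 * MvPolynomial.X 1 * (MvPolynomial.X 0 + MvPolynomial.X 1) :
        MvPolynomial (Fin 3) A)).IsHomogeneous (1 + 1 + 1) :=
      ((MvPolynomial.isHomogeneous_X A 0).mul (MvPolynomial.isHomogeneous_X A 1)).mul
        ((MvPolynomial.isHomogeneous_X A 0).add (MvPolynomial.isHomogeneous_X A 1))
    exact h.C_mul v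
  · exact MvPolynomial.isHomogeneous_C_mul_X_pow w 2 3

/-- The reduced dehomogenisations of the tie cubic on the three charts: `T₂ := 1` gives `v̄·T₀T₁(T₀+T₁) + w̄`,
`T₀ := 1` gives `v̄·T₁(1+T₁) + w̄T₂³`, `T₁ := 1` gives `v̄·T₀(1+T₀) + w̄T₂³`. [folklore] -/
theorem map_dehomogenize_tieCubic (v w : A) :
    MvPolynomial.map (Ideal.Quotient.mk (Ideal.span (Set.range x))) (dehomogenize (2 : Fin 3)
        (MvPolynomial.C v * (MvPolynomial.X 0 * MvPolynomial.X 1 * (MvPolynomial.X 0 + MvPolynomial.X 1)) +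
          MvPolynomial.C w * MvPolynomial.X 2 ^ 3 : MvPolynomial (Fin 3) A)) =
      MvPolynomial.C (Ideal.Quotient.mk _ v) *
          (MvPolynomial.X ⟨0, by decide⟩ * MvPolynomial.X ⟨1, by decide⟩ *
            (MvPolynomial.X ⟨0, by decide⟩ + MvPolynomial.X ⟨1, by decide⟩)) +
        MvPolynomial.C (Ideal.Quotient.mk _ w) ∧
    MvPolynomial.map (Ideal.Quotient.mk (Ideal.span (Set.range x))) (dehomogenize (0 : Fin 3)
        (MvPolynomial.C v * (MvPolynomial.X 0 * MvPolynomial.X 1 * (MvPolynomial.X 0 + MvPolynomial.X 1)) +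
          MvPolynomial.C w * MvPolynomial.X 2 ^ 3 : MvPolynomial (Fin 3) A)) =
      MvPolynomial.C (Ideal.Quotient.mk _ v) * (MvPolynomial.X ⟨1, by decide⟩ * (1 + MvPolynomial.X ⟨1, by decide⟩)) +
        MvPolynomial.C (Ideal.Quotient.mk _ w) * MvPolynomial.X ⟨2, by decide⟩ ^ 3 ∧
    MvPolynomial.map (Ideal.Quotient.mk (Ideal.span (Set.range x))) (dehomogenize (1 : Fin 3)
        (MvPolynomial.C v * (MvPolynomial.X 0 * MvPolynomial.X 1 * (MvPolynomial.X 0 + MvPolynomial.X 1)) +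
          MvPolynomial.C w * MvPolynomial.X 2 ^ 3 : MvPolynomial (Fin 3) A)) =
      MvPolynomial.C (Ideal.Quotient.mk _ v) * (MvPolynomial.X ⟨0, by decide⟩ * (1 + MvPolynomial.X ⟨0, by decide⟩)) +
        MvPolynomial.C (Ideal.Quotient.mk _ w) * MvPolynomial.X ⟨2, by decide⟩ ^ 3 := by
  refine ⟨?_, ?_, ?_⟩
  · simp only [map_add, map_mul, map_pow, MvPolynomial.aeval_C, MvPolynomial.aeval_X, MvPolynomial.algebraMap_eq,
      killVar_self, killVar_of_ne (2 : Fin 3) (show (0 : Fin 3) ≠ 2 by decide),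
      killVar_of_ne (2 : Fin 3) (show (1 : Fin 3) ≠ 2 by decide), MvPolynomial.map_C, MvPolynomial.map_X, one_pow,
      mul_one]
  · simp only [map_add, map_mul, map_pow, MvPolynomial.aeval_C, MvPolynomial.aeval_X, MvPolynomial.algebraMap_eq,
      killVar_self, killVar_of_ne (0 : Fin 3) (show (1 : Fin 3) ≠ 0 by decide),
      killVar_of_ne (0 : Fin 3) (show (2 : Fin 3) ≠ 0 by decide), MvPolynomial.map_C, MvPolynomial.map_X, map_one,
      one_mul]
  · simp only [map_add, map_mul, map_pow, MvPolynomial.aeval_C, MvPolynomial.aeval_X, MvPolynomial.algebraMap_eq,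
      killVar_self, killVar_of_ne (1 : Fin 3) (show (0 : Fin 3) ≠ 1 by decide),
      killVar_of_ne (1 : Fin 3) (show (2 : Fin 3) ≠ 1 by decide), MvPolynomial.map_C, MvPolynomial.map_X, map_one,
      mul_one]
    ring

/-- **The Jacobian condition for the tie cubic holds on every chart** when `3`, `v̄`, `w̄` are units of `A/I`
(e.g. residue characteristic `2`, the S-F case, where `3 = 1`; it FAILS in residue characteristic `3`, where the
cubic `T₀T₁(T₀+T₁) + T₂³` is singular at `[1:1:1]` — not claimed). [folklore] -/
theorem one_mem_jacobian_tieCubic (v w : A) (h3 : IsUnit (3 : A ⧸ Ideal.span (Set.range x)))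
    (hv : IsUnit (Ideal.Quotient.mk (Ideal.span (Set.range x)) v))
    (hw : IsUnit (Ideal.Quotient.mk (Ideal.span (Set.range x)) w)) (i : Fin 3) :
    (1 : MvPolynomial {j : Fin 3 // j ≠ i} (A ⧸ Ideal.span (Set.range x))) ∈
      Ideal.span {MvPolynomial.map (Ideal.Quotient.mk (Ideal.span (Set.range x))) (dehomogenize i
          (MvPolynomial.C v * (MvPolynomial.X 0 * MvPolynomial.X 1 * (MvPolynomial.X 0 + MvPolynomial.X 1)) +
            MvPolynomial.C w * MvPolynomial.X 2 ^ 3 : MvPolynomial (Fin 3) A))} ⊔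
        Ideal.span (Set.range fun j : {j : Fin 3 // j ≠ i} => MvPolynomial.pderiv j
          (MvPolynomial.map (Ideal.Quotient.mk (Ideal.span (Set.range x))) (dehomogenize i
            (MvPolynomial.C v * (MvPolynomial.X 0 * MvPolynomial.X 1 * (MvPolynomial.X 0 + MvPolynomial.X 1)) +
              MvPolynomial.C w * MvPolynomial.X 2 ^ 3 : MvPolynomial (Fin 3) A)))) := by
  obtain ⟨h2, h0, h1⟩ := map_dehomogenize_tieCubic x v w
  have hi : i = 0 ∨ i = 1 ∨ i = 2 := by fin_cases i <;> simp
  rcases hi with rfl | rfl | rfl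
  · rw [h0]
    exact one_mem_jacobian_tieCubic_lineChart _ _ (by decide) _ _ h3 hv
  · rw [h1]
    exact one_mem_jacobian_tieCubic_lineChart _ _ (by decide) _ _ h3 hv
  · rw [h2]
    exact one_mem_jacobian_tieCubic_vertexChart _ _ (by decide) _ _ h3 hw

/-- **T-EBETA-PRIME at an S-F TIE POINT (the (E-β′) centre is regular along its exceptional cubic).** `A`, `A/I`
regular rings, `x = (x₀, x₁, x₂)` quasi-regular generating `I` (at a tie point: the regular local ring of the carrier
`E_O ≅ ℙ²_{O′}` at `q̃` with parameters `x, y, ϖ`), `3`, `v̄`, `w̄` units of `A/I` (residue characteristic `2` in S-F);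
the hypersurface `G = v·x₀x₁(x₀+x₁) + w·x₂³ + Ψ`, `Ψ ∈ I⁴` (the `O′`-model `D = V(F̃₇ + ϖ³U)` in local coordinates,
LEAD-MEMO-2 §6 / PLANNER-MEMO v2 M3). Then on EVERY chart `A[I/xᵢ]` and at EVERY prime `𝔐 ⊇ (t, g₁)` of the
exceptional divisor, the local ring `A[I/xᵢ]_𝔐/(g₁)` of the strict transform `g₁ = Φ(e) + tψ` (`G = t³ g₁`, part 1
`exists_algebraMap_tangentCone_eq` with `isHomogeneous_tieCubic`) is a REGULAR local ring — `Bl_q(D)` is regular along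
its exceptional curve, which by part 1 (`exists_quotient_strictTransform_sup_equiv`) is the smooth cubic
`v̄ T₀T₁(T₀+T₁) + w̄ T₂³ = 0`. [cite: Matsumura1987, Thm. 14.2] [cite: Liu2002, Thm. 8.1.19 (a)] [OURS · L1 W4.5b]
T-EBETA-PRIME instance toward `stub_elnat_three_isolated_nonabs` (K4.5e arm T, specimen S-F); NOT a statement of the
manuscript; the E1 matching of the cubic with `ℙ(TC_q H₁)` (jet condition) and the points off `E` are not addressed. -/
theorem isRegularLocalRing_quotient_strictTransform_tieCubic [IsRegularRing A] (hx : IsQuasiRegular x)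
    [IsRegularRing (A ⧸ Ideal.span (Set.range x))] (v w : A) (h3 : IsUnit (3 : A ⧸ Ideal.span (Set.range x)))
    (hv : IsUnit (Ideal.Quotient.mk (Ideal.span (Set.range x)) v))
    (hw : IsUnit (Ideal.Quotient.mk (Ideal.span (Set.range x)) w)) (i : Fin 3)
    (ψ : blowupAlgebra (Ideal.span (Set.range x)) (x i))
    (𝔐 : Ideal (blowupAlgebra (Ideal.span (Set.range x)) (x i))) [𝔐.IsPrime]
    (hxi : algebraMap A (blowupAlgebra (Ideal.span (Set.range x)) (x i)) (x i) ∈ 𝔐)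
    (hg : MvPolynomial.aeval (blowupAlgebra.frac x i)
          (MvPolynomial.C v * (MvPolynomial.X 0 * MvPolynomial.X 1 * (MvPolynomial.X 0 + MvPolynomial.X 1)) +
            MvPolynomial.C w * MvPolynomial.X 2 ^ 3 : MvPolynomial (Fin 3) A) +
        algebraMap A (blowupAlgebra (Ideal.span (Set.range x)) (x i)) (x i) * ψ ∈ 𝔐)
    (S : Type u) [CommRing S] [Algebra (blowupAlgebra (Ideal.span (Set.range x)) (x i)) S]
    [IsLocalization.AtPrime S 𝔐] :
    IsRegularLocalRing (S ⧸ Ideal.span {algebraMap (blowupAlgebra (Ideal.span (Set.range x)) (x i)) S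
        (MvPolynomial.aeval (blowupAlgebra.frac x i)
          (MvPolynomial.C v * (MvPolynomial.X 0 * MvPolynomial.X 1 * (MvPolynomial.X 0 + MvPolynomial.X 1)) +
            MvPolynomial.C w * MvPolynomial.X 2 ^ 3 : MvPolynomial (Fin 3) A) +
          algebraMap A (blowupAlgebra (Ideal.span (Set.range x)) (x i)) (x i) * ψ)}) :=
  isRegularLocalRing_quotient_strictTransform_of_mem_span x i hx _ (one_mem_jacobian_tieCubic x v w h3 hv hw i)
    ψ 𝔐 hxi hg S

end TieCubic

end Summit.ResolutionOfSingularities.ResolutionOfSingularities.Cruxes.EquisingularLiftNat.Sections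

end
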